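import Summits.HubbardSuperconductivity.HubbardLadder.PairCorrSectorCert
import Literature.MathematicalPhysics.QuantumLattice.HubbardNNNHoppingFluxStiffnessSecondOrder
import Literature.MathematicalPhysics.QuantumLattice.HubbardNNNHoppingWindowCertificate
import HarnessLib

/-!
# Ventures/CertifiedManyBodySolver — Rows/TorusStiffnessThreeCert.lean

HONEST FRAMING: one-sided CEILINGS on a finite-torus flux stiffness from certified numbers; not a superconductivity verdict; no
floor is obtainable in this constraint class (hubbard-obs-p2 STIFFNESS-SDP.md §4).

The **three-certificate stiffness ceiling** of the hubbard-obs cell (TARGET §5 rung 0c "F-torus-3win", hubbard-obs-p2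
STIFFNESS-SDP.md T2/T3 and TARGET.md §5 ★(a)) as CLAIM-NODE GLUE: three sector-mode OBSERVABLE certificates
`TorusSectorObsCertTT' L 1 t' U N 0 u X q` (HubbardLadder/PairCorrSectorCert.lean; FORMAT-certsdp1 §3/§7/§9, the R2/R3 device of
pub-hubbard's #197-class rows) for the `(N, S^z = 0)` sector of the `t–t'` torus `hubbardTorusTT' L 1 t' U`, `N = 2⌊(1 − δ)L²/2⌋`, with the
objectives
* `X = −𝒦` (`𝒦 = kinOpTT' L t'`, the `e₁`-kinetic operator; value `qK`, i.e. `½ Re⟨ψ, 𝒦ψ⟩ ≤ −qK/2 =: K_hi`),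
* `X = 𝒥·𝒥` (`𝒥 = curOpTT' L t'`, the `e₁`-current; value `qM0`, i.e. `‖𝒥ψ‖² ≥ qM0 =: M0_lo`),
* `X = −(𝒥[H,𝒥] − [H,𝒥]𝒥)` (`curFirstMomentOpTT'`, twice the first moment `D₁ = ½[𝒥,[H,𝒥]]` of the current strength function;
  value `qM1`, i.e. `Re⟨𝒥ψ,(H − E₀)𝒥ψ⟩ ≤ −qM1/2 =: M1_hi`, by `curOpTT'_firstMoment_eq_re_doubleCommutator`),
all with the SAME energy-hypothesis constant `u ≥ E₀ = minEnergyOn (szSector N 0)` (discharged by a landed torus energy UPPER node), give — by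
hubbard-obs-p2's `stiffnessTT'_mul_sq_le_of_certified_moments` (Kohn's second-order term minorised by the Bohigas–Lane–Martorell sum-rule
inequality `m₋₁ ≥ m₀²/m₁`) — for EVERY `ρ` with `E_L(θ) − E_L(0) ≥ ρθ²` on a neighbourhood of `θ = 0` (`fluxEnergyTT'`):
`ρ · L² ≤ K_hi − M0_lo²/M1_hi = −qK/2 − qM0²/(−qM1/2)` (`stiffnessTT'_mul_sq_le_of_three_certs`, ψ-free: a unit sector ground state exists by
`szSector_groundState_of_preservesSectors` and normalisation). The per-certificate EDGES (`kin_half_le_of_cert`, `curNormSq_ge_of_cert`,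
`curFirstMoment_le_of_cert`) are stated separately so that a producer objective differing by a scalar needs only a new two-line edge.
A claim-node file for a concrete run (4 × 4, `U = 8`, `N = 14`, `t' ∈ {0, −1/4}`; hubbard-obs-p2/ops/ word files `K_nn/K_d`, `M0_*`, `D1U_*`)
instantiates `stiffnessTT'_mul_sq_le_of_three_certs` with three `Nonempty (TorusSectorObsCertTT' 4 1 t' 8 14 0 u X q)` nodes (or the `M = 0`
members of all-`S^z` nodes) and the torus energy node via `minEnergyOn_szSector_le_of_groundEnergy_rect_le`; `fourteen_eq_sectorN_four` below is
the sector-index arithmetic `2⌊(1 − 1/8)·4²/2⌋ = 14`.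

References: W. Kohn, Phys. Rev. 133 (1964) A171 [Kohn1964]; D. J. Scalapino, S. R. White, S. C. Zhang, PRB 47 (1993) 7995, §II
[ScalapinoWhiteZhang1993]; O. Bohigas, A. M. Lane, J. Martorell, Phys. Rep. 51 (1979) 267 [BohigasLaneMartorell1979]; E. Lipparini, Modern
Many-Particle Physics (2008), eqs. (8.30), (10.64) [Lipparini2008]; the certificate format: Wang et al. 2024 §3 eq. (obsopt) [WangEtAl2024],
Han 2020 §2 [Han2020Bootstrap].
-/

noncomputable section

namespace Summit.Ventures.CertifiedManyBodySolver.Rows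

open Matrix Literature.MathematicalPhysics.QuantumLattice Literature.Probability.LatticeModels
open Summit.HubbardSuperconductivity.HubbardLadder
open scoped ComplexOrder

variable {L : ℕ} [NeZero L]

/-- The **current first-moment operator** `𝒥(H𝒥 − 𝒥H) − (H𝒥 − 𝒥H)𝒥 = [𝒥,[H,𝒥]]` of the `t–t'` torus (`𝒥 = curOpTT' L t'`,
`H = hubbardTorusTT' L 1 t' U`) — TWICE the operator `D₁ = ½[𝒥,[H,𝒥]]` whose ground-state expectation is the first moment `m₁` of the
current strength function (`curOpTT'_firstMoment_eq_re_doubleCommutator`): a fixed Hermitian fermion polynomial of degree ≤ 4, hence an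
SDP objective (hubbard-obs-p2/ops/ `D1U_*` + hopping parts). [cite: Lipparini2008, eq. (8.30)] -/
def curFirstMomentOpTT' (L : ℕ) [NeZero L] (t' U : ℝ) :
    Matrix (Finset (Orb (FermionTorus 2 L))) (Finset (Orb (FermionTorus 2 L))) ℂ :=
  curOpTT' L t' * (hubbardTorusTT' L 1 t' U * curOpTT' L t' - curOpTT' L t' * hubbardTorusTT' L 1 t' U) -
    (hubbardTorusTT' L 1 t' U * curOpTT' L t' - curOpTT' L t' * hubbardTorusTT' L 1 t' U) * curOpTT' L t'

/-- Unfolding lemma for `curFirstMomentOpTT'` (the word a producer's objective must equal). [cite: Lipparini2008, eq. (8.30)] -/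
theorem curFirstMomentOpTT'_def (t' U : ℝ) :
    curFirstMomentOpTT' L t' U =
      curOpTT' L t' * (hubbardTorusTT' L 1 t' U * curOpTT' L t' - curOpTT' L t' * hubbardTorusTT' L 1 t' U) -
        (hubbardTorusTT' L 1 t' U * curOpTT' L t' - curOpTT' L t' * hubbardTorusTT' L 1 t' U) * curOpTT' L t' :=
  rfl

/-! ### The three edges: certificate ⇒ Rayleigh-quantity bound for a unit sector ground state -/

section Edges

variable {t' U : ℝ} {N : ℕ} {M u q : ℝ}

/-- **K edge.** A sector certificate for `−𝒦` with value `q` gives `½ Re⟨ψ, 𝒦ψ⟩ ≤ −q/2` for every unit `(N, M)`-sector ground state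
(energy hypothesis `E₀ ≤ u`). [cite: WangEtAl2024, §3 eq. (obsopt)] -/
theorem kin_half_le_of_cert (C : TorusSectorObsCertTT' L 1 t' U N M u (-kinOpTT' L t') q)
    (hE : (hubbardTorusTT' L 1 t' U).minEnergyOn (szSector N M) ≤ u)
    {ψ : Fock (Orb (FermionTorus 2 L))} (hψ1 : star ψ ⬝ᵥ ψ = 1)
    (hgs : IsGroundStateInSector (hubbardTorusTT' L 1 t' U) N M ψ) :
    (star ψ ⬝ᵥ (kinOpTT' L t' *ᵥ ψ)).re / 2 ≤ -q / 2 := by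
  have h := C.re_expect_le hE ψ hψ1 hgs
  linarith

/-- **M₀ edge.** A sector certificate for `𝒥·𝒥` with value `q` gives `q ≤ ‖𝒥ψ‖²` for every unit `(N, M)`-sector ground state.
[cite: Lipparini2008, eq. (8.30)] -/
theorem curNormSq_ge_of_cert (C : TorusSectorObsCertTT' L 1 t' U N M u (curOpTT' L t' * curOpTT' L t') q)
    (hE : (hubbardTorusTT' L 1 t' U).minEnergyOn (szSector N M) ≤ u)
    {ψ : Fock (Orb (FermionTorus 2 L))} (hψ1 : star ψ ⬝ᵥ ψ = 1)
    (hgs : IsGroundStateInSector (hubbardTorusTT' L 1 t' U) N M ψ) :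
    q ≤ (star (curOpTT' L t' *ᵥ ψ) ⬝ᵥ (curOpTT' L t' *ᵥ ψ)).re := by
  have h := C.re_expect_ge hE ψ hψ1 hgs
  rwa [← mulVec_mulVec, star_dotProduct_curOpTT'_curOpTT'_mulVec] at h

/-- **M₁ edge.** A sector certificate for `−(𝒥[H,𝒥] − [H,𝒥]𝒥)` with value `q` gives
`Re⟨𝒥ψ, H𝒥ψ⟩ − E₀‖𝒥ψ‖² ≤ −q/2` (`E₀ = minEnergyOn (szSector N M)`) for every unit `(N, M)`-sector ground state — the first moment as
the expectation of ONE fermion polynomial (`curOpTT'_firstMoment_eq_re_doubleCommutator`). [cite: Lipparini2008, eq. (8.30)] -/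
theorem curFirstMoment_le_of_cert (C : TorusSectorObsCertTT' L 1 t' U N M u (-curFirstMomentOpTT' L t' U) q)
    (hE : (hubbardTorusTT' L 1 t' U).minEnergyOn (szSector N M) ≤ u)
    {ψ : Fock (Orb (FermionTorus 2 L))} (hψ1 : star ψ ⬝ᵥ ψ = 1)
    (hgs : IsGroundStateInSector (hubbardTorusTT' L 1 t' U) N M ψ) :
    (star (curOpTT' L t' *ᵥ ψ) ⬝ᵥ (hubbardTorusTT' L 1 t' U *ᵥ (curOpTT' L t' *ᵥ ψ))).re -
        (hubbardTorusTT' L 1 t' U).minEnergyOn (szSector N M) *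
          (star (curOpTT' L t' *ᵥ ψ) ⬝ᵥ (curOpTT' L t' *ᵥ ψ)).re ≤ -q / 2 := by
  have h := C.re_expect_le hE ψ hψ1 hgs
  rw [curOpTT'_firstMoment_eq_re_doubleCommutator t' U hgs]
  rw [curFirstMomentOpTT'_def] at h
  linarith

end Edges

/-! ### Unit sector ground states exist -/

/-- A sector ground state can be normalised: the `(N, M)` sector ground space of any `H` that has a ground state `ψ` contains a UNIT
ground state. [folklore] -/
theorem exists_unit_of_isGroundStateInSector {Λ : Type*} [LinearOrder Λ] [Fintype Λ]
    {H : Matrix (Finset (Orb Λ)) (Finset (Orb Λ)) ℂ} {N : ℕ} {M : ℝ} {ψ : Fock (Orb Λ)}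
    (h : IsGroundStateInSector H N M ψ) :
    ∃ φ : Fock (Orb Λ), IsGroundStateInSector H N M φ ∧ star φ ⬝ᵥ φ = 1 := by
  obtain ⟨hmem, hne, hH⟩ := h
  set r : ℝ := (star ψ ⬝ᵥ ψ).re with hr
  have hrpos : 0 < r := RayleighBottom.re_star_dotProduct_self_pos hne
  have hψψ : star ψ ⬝ᵥ ψ = (r : ℂ) := by
    rw [hr, RayleighBottom.star_dotProduct_self_eq_sum, Complex.ofReal_re]
  set c : ℝ := (Real.sqrt r)⁻¹ with hc
  have hcpos : 0 < c := inv_pos.2 (Real.sqrt_pos.2 hrpos)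
  have hc0 : (c : ℂ) ≠ 0 := by exact_mod_cast hcpos.ne'
  refine ⟨(c : ℂ) • ψ, ⟨Submodule.smul_mem _ _ hmem, smul_ne_zero hc0 hne, ?_⟩, ?_⟩
  · rw [mulVec_smul, hH, smul_comm]
  · rw [star_smul, smul_dotProduct, dotProduct_smul, hψψ, Complex.star_def, Complex.conj_ofReal, smul_eq_mul,
      smul_eq_mul, ← Complex.ofReal_mul, ← Complex.ofReal_mul]
    have : c * (c * r) = 1 := by
      rw [← mul_assoc, hc, ← mul_inv, Real.mul_self_sqrt hrpos.le, inv_mul_cancel₀ hrpos.ne']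
    exact_mod_cast this

/-- The `t–t'` torus conserves `(N↑, N↓)` (the flux family at `θ = 0`). [cite: LiebPRL1989, Remark (2)] -/
theorem preservesSectors_hubbardTorusTT'_one (t' U : ℝ) : PreservesSectors (hubbardTorusTT' L 1 t' U) := by
  simpa using preservesSectors_hubbardTorusTT'Flux (L := L) t' U 0

/-- A UNIT ground state of the `(2n, S^z = 0)` sector of the `t–t'` torus exists (`n ≤ |Λ|`).
[cite: LiebPRL1989, proof of Theorem 1] -/
theorem exists_unit_groundStateInSector_hubbardTorusTT' (t' U : ℝ) {n : ℕ} (hn : n ≤ Fintype.card (FermionTorus 2 L)) :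
    ∃ φ : Fock (Orb (FermionTorus 2 L)), IsGroundStateInSector (hubbardTorusTT' L 1 t' U) (2 * n) 0 φ ∧ star φ ⬝ᵥ φ = 1 := by
  obtain ⟨⟨ψ, hψ⟩, -⟩ := szSector_groundState_of_preservesSectors (hubbardTorusTT'_isHermitian L 1 t' U)
    (preservesSectors_hubbardTorusTT'_one (L := L) t' U) hn
  exact exists_unit_of_isGroundStateInSector hψ

/-! ### The three-certificate ceiling -/

/-- **Three-certificate stiffness ceiling, per ground state** (`L ≥ 3`): sector certificates for `−𝒦` (value `qK`), `𝒥𝒥` (value `qM0 ≥ 0`)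
and `−(𝒥[H,𝒥] − [H,𝒥]𝒥)` (value `qM1 < 0`) in the `(N, 0)` sector, `N = 2⌊(1−δ)L²/2⌋`, with the energy hypothesis `E₀ ≤ u`, give for every
unit sector ground state `ψ` and every `ρ` with `ρθ² ≤ E_L(θ) − E_L(0)` for `|θ| ≤ θ₀` (`θ₀ > 0`):
`ρ L² ≤ −qK/2 − qM0²/(−qM1/2)` (= `K_hi − M0_lo²/M1_hi`). [cite: Lipparini2008, eq. (10.64)] [cite: ScalapinoWhiteZhang1993, §II] -/
theorem stiffnessTT'_mul_sq_le_of_three_certs_of_groundState (hL : 3 ≤ L) (t' U δ : ℝ) {u qK qM0 qM1 : ℝ}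
    (CK : TorusSectorObsCertTT' L 1 t' U (2 * ⌊(1 - δ) * (L : ℝ) ^ 2 / 2⌋₊) 0 u (-kinOpTT' L t') qK)
    (CM0 : TorusSectorObsCertTT' L 1 t' U (2 * ⌊(1 - δ) * (L : ℝ) ^ 2 / 2⌋₊) 0 u (curOpTT' L t' * curOpTT' L t') qM0)
    (CM1 : TorusSectorObsCertTT' L 1 t' U (2 * ⌊(1 - δ) * (L : ℝ) ^ 2 / 2⌋₊) 0 u (-curFirstMomentOpTT' L t' U) qM1)
    (hE : (hubbardTorusTT' L 1 t' U).minEnergyOn (szSector (2 * ⌊(1 - δ) * (L : ℝ) ^ 2 / 2⌋₊) 0) ≤ u)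
    (hM0nn : 0 ≤ qM0) (hM1neg : qM1 < 0)
    {ψ : Fock (Orb (FermionTorus 2 L))}
    (hgs : IsGroundStateInSector (hubbardTorusTT' L 1 t' U) (2 * ⌊(1 - δ) * (L : ℝ) ^ 2 / 2⌋₊) 0 ψ)
    (h1 : star ψ ⬝ᵥ ψ = 1) {ρs θ₀ : ℝ} (hθ₀ : 0 < θ₀)
    (hstiff : ∀ θ : ℝ, |θ| ≤ θ₀ → ρs * θ ^ 2 ≤ fluxEnergyTT' L t' U δ θ - fluxEnergyTT' L t' U δ 0) :
    ρs * (L : ℝ) ^ 2 ≤ -qK / 2 - qM0 ^ 2 / (-qM1 / 2) := by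
  have hflux0 : fluxEnergyTT' L t' U δ 0 =
      (hubbardTorusTT' L 1 t' U).minEnergyOn (szSector (2 * ⌊(1 - δ) * (L : ℝ) ^ 2 / 2⌋₊) 0) := by
    rw [fluxEnergyTT'_eq, hubbardTorusTT'Flux_zero]
  have hM1' := curFirstMoment_le_of_cert CM1 hE h1 hgs
  rw [← hflux0] at hM1'
  exact stiffnessTT'_mul_sq_le_of_certified_moments hL t' U δ hθ₀ hstiff hgs h1
    (kin_half_le_of_cert CK hE h1 hgs) (curNormSq_ge_of_cert CM0 hE h1 hgs) hM0nn hM1' (by linarith)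

/-- **Three-certificate stiffness ceiling** (ψ-free form; `L ≥ 3`, `⌊(1−δ)L²/2⌋ ≤ |Λ|`): under the hypotheses of
`stiffnessTT'_mul_sq_le_of_three_certs_of_groundState`, EVERY `ρ` with `ρθ² ≤ E_L(θ) − E_L(0)` for `|θ| ≤ θ₀` satisfies
`ρ L² ≤ −qK/2 − qM0²/(−qM1/2)` — a one-sided CEILING on the flux stiffness of the finite torus from three certified moments (no floor is
claimed or obtainable this way). [cite: Lipparini2008, eq. (10.64)] [cite: ScalapinoWhiteZhang1993, §II] -/
theorem stiffnessTT'_mul_sq_le_of_three_certs (hL : 3 ≤ L) (t' U δ : ℝ) {u qK qM0 qM1 : ℝ}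
    (hn : ⌊(1 - δ) * (L : ℝ) ^ 2 / 2⌋₊ ≤ Fintype.card (FermionTorus 2 L))
    (CK : TorusSectorObsCertTT' L 1 t' U (2 * ⌊(1 - δ) * (L : ℝ) ^ 2 / 2⌋₊) 0 u (-kinOpTT' L t') qK)
    (CM0 : TorusSectorObsCertTT' L 1 t' U (2 * ⌊(1 - δ) * (L : ℝ) ^ 2 / 2⌋₊) 0 u (curOpTT' L t' * curOpTT' L t') qM0)
    (CM1 : TorusSectorObsCertTT' L 1 t' U (2 * ⌊(1 - δ) * (L : ℝ) ^ 2 / 2⌋₊) 0 u (-curFirstMomentOpTT' L t' U) qM1)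
    (hE : (hubbardTorusTT' L 1 t' U).minEnergyOn (szSector (2 * ⌊(1 - δ) * (L : ℝ) ^ 2 / 2⌋₊) 0) ≤ u)
    (hM0nn : 0 ≤ qM0) (hM1neg : qM1 < 0) {ρs θ₀ : ℝ} (hθ₀ : 0 < θ₀)
    (hstiff : ∀ θ : ℝ, |θ| ≤ θ₀ → ρs * θ ^ 2 ≤ fluxEnergyTT' L t' U δ θ - fluxEnergyTT' L t' U δ 0) :
    ρs * (L : ℝ) ^ 2 ≤ -qK / 2 - qM0 ^ 2 / (-qM1 / 2) := by
  obtain ⟨ψ, hgs, h1⟩ := exists_unit_groundStateInSector_hubbardTorusTT' (L := L) t' U hn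
  exact stiffnessTT'_mul_sq_le_of_three_certs_of_groundState hL t' U δ CK CM0 CM1 hE hM0nn hM1neg hgs h1 hθ₀ hstiff

/-! ### The cell's instance arithmetic: `4 × 4`, `δ = 1/8` ⇒ sector `N = 14` -/

/-- `2⌊(1 − 1/8)·4²/2⌋ = 14`: the hubbard-obs anchor sector on the `4 × 4` torus. Decidable arithmetic. -/
theorem fourteen_eq_sectorN_four : 2 * ⌊(1 - (1 / 8 : ℝ)) * ((4 : ℕ) : ℝ) ^ 2 / 2⌋₊ = 14 := by
  have h : (1 - (1 / 8 : ℝ)) * ((4 : ℕ) : ℝ) ^ 2 / 2 = (7 : ℕ) := by norm_num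
  rw [h, Nat.floor_natCast]

/-- `⌊(1 − 1/8)·4²/2⌋ = 7 ≤ 16 = |Λ|` on the `4 × 4` torus (hypothesis `hn` of `stiffnessTT'_mul_sq_le_of_three_certs`). -/
theorem sectorHalf_four_le_card : ⌊(1 - (1 / 8 : ℝ)) * ((4 : ℕ) : ℝ) ^ 2 / 2⌋₊ ≤ Fintype.card (FermionTorus 2 4) := by
  have h : (1 - (1 / 8 : ℝ)) * ((4 : ℕ) : ℝ) ^ 2 / 2 = (7 : ℕ) := by norm_num
  rw [h, Nat.floor_natCast]
  simp [FermionTorus, Fintype.card_pi]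

/-- **The `4 × 4`, `U = 8`, `n = 7/8` instance shape** (both `t'`): three `(14, S^z = 0)`-sector certificates with a common energy
hypothesis `u` and `E₀(4×4; 14, S^z = 0) ≤ u` give `16 ρ ≤ −qK/2 − qM0²/(−qM1/2)` for every flux-stiffness constant `ρ` of
`fluxEnergyTT' 4 t' 8 (1/8)`. The claim-node file feeds `Nonempty (TorusSectorObsCertTT' 4 1 t' 8 14 0 u X q)` nodes (`.some`) and the torus
energy node (`minEnergyOn_szSector_le_of_groundEnergy_rect_le`). [cite: ScalapinoWhiteZhang1993, §II] -/
theorem sixteen_mul_stiffness_le_of_three_certs_4x4 (t' : ℝ) {u qK qM0 qM1 : ℝ}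
    (CK : TorusSectorObsCertTT' 4 1 t' 8 14 0 u (-kinOpTT' 4 t') qK)
    (CM0 : TorusSectorObsCertTT' 4 1 t' 8 14 0 u (curOpTT' 4 t' * curOpTT' 4 t') qM0)
    (CM1 : TorusSectorObsCertTT' 4 1 t' 8 14 0 u (-curFirstMomentOpTT' 4 t' 8) qM1)
    (hE : (hubbardTorusTT' 4 1 t' 8).minEnergyOn (szSector 14 0) ≤ u)
    (hM0nn : 0 ≤ qM0) (hM1neg : qM1 < 0) {ρs θ₀ : ℝ} (hθ₀ : 0 < θ₀)
    (hstiff : ∀ θ : ℝ, |θ| ≤ θ₀ → ρs * θ ^ 2 ≤ fluxEnergyTT' 4 t' 8 (1 / 8) θ - fluxEnergyTT' 4 t' 8 (1 / 8) 0) :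
    16 * ρs ≤ -qK / 2 - qM0 ^ 2 / (-qM1 / 2) := by
  have h14 := fourteen_eq_sectorN_four
  have h := stiffnessTT'_mul_sq_le_of_three_certs (L := 4) (by norm_num) t' 8 (1 / 8) (u := u) (qK := qK) (qM0 := qM0)
    (qM1 := qM1) sectorHalf_four_le_card (by rw [h14]; exact CK) (by rw [h14]; exact CM0) (by rw [h14]; exact CM1)
    (by rw [h14]; exact hE) hM0nn hM1neg hθ₀ hstiff
  have h16 : ((4 : ℕ) : ℝ) ^ 2 = 16 := by norm_num
  rw [h16] at h
  linarith

end Summit.Ventures.CertifiedManyBodySolver.Rows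

end
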